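import Literature.NumberTheory.Rogawski1990.ArchStableSumG    -- ★-cand PART 1 (this seat): `stableTwistG`, `stableSumG`, `archERhoG_mul_stableSumG`, `slotPerm_hcSwapAt`, `partnerPerms_induction`, `StInRegG`
import HarnessLib

/-!
# `stableSumG`, PART 2 — the full Weyl symmetry (W^st) of the stable sum, the multiplicity identity on the regular set, inheritance of (P) and (I₄)
# (Shelstad 1979 §4 pp. 22–26, Lemma 4.2; Bouaziz 1994 §6.2 p. 591; Rogawski 1990 §4.1 (4.1.1), §4.3 (4.3.1))

Topic `NumberTheory/Rogawski1990`; namespace `Literature.NumberTheory.Rogawski1990`.  One definition WITH BODY (`ArchHcStableWeyl`) + theorems (no instance, no notation, no axiom,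
no named fact, no `sorry`).  Cell `pub/hodgecm-mathlib`, crux H413 = `stmt-HodgeConjecture-24833`, road «N8-INNER» brick **(2) «STABLE-SUM-G»** (dealer LH2-plan (g1) DEAL #1
2026-09-02T15:34:48Z), FILE 1 PART 2; seat LH10-p02 (g9).  PART 1 ★-cand `ArchStableSumG` defines the stable sum `stableSumG F S′ c = Σ_{ρ ∈ partnerPerms S′} u_ρ(c) · F S′ (ρ·c)`
and proves its alternating reading `archERhoG · stableSumG F = Σ_ρ sign ρ · (archERhoG • F)(ρ·c)`.

* §1 **`ArchHcStableWeyl F`** — (W^st): the division-free twisted relation `F S′ (swap c) · archRG S′ c = archRG S′ (swap c) · F S′ c` under EVERY transposition of two slots at EVERY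
  compact place (no sign guard: realised and non-realised reflections alike) + `x`-evenness at the split places (★ `ArchHcWeyl s` asks the first clause for the realised swaps only);
  `archERhoG_mul_stableSumG_hcSwapAt` (`'F^st(swap c) = −'F^st(c)` for ANY `F`: reindexing ★ `sum_partnerPerms_comp_update` + ★ `prod_sign_update_swap_mul`);
  **`archHcStableWeyl_stableSumG`**: the stable sum of ANY `x`-even family is (W^st) (with the alternation of the Weyl denominator ★ `archERhoG_mul_archRG_slotPerm`);
  **`stableSumG_eq_card_mul_of_mem_regG`**: on `RegG S′` a (W^st) family is reproduced `|partnerPerms S′| = 6^{#(univ ∖ S′)}` times by its stable sum (★-cand `partnerPerms_induction`,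
  one transposition at a time) — so the image of `stableSumG` on the `x`-even families is the (W^st) families up to that positive multiplicity (wall values are conventional);
  idempotence `stableSumG_stableSumG_of_mem_regG`.
* §2 inheritance: `archHcPeriodic_stableSumG` ((P)), `archHcCompactSupport_stableSumG` ((I₄)).
WARNING (SIGSHEET v1 §2, this seat): `stableSumG F` of a member `F ∈ ArchHCSpaceG s jc′` is NOT a member of `ArchHCSpaceG s jc′` — its (W^st)-symmetry makes EVERY imaginary wall a jump
wall (clause (I₁) fails across the compact walls) and the jump constants at the noncompact walls double; the stable space is the IMAGE of `stableSumG` (or carries its own clause set on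
★-cand `StInRegG`), FILE 2.  HONEST LABEL: count-neutral; HC_CM is proved only modulo the 7 printed citations (2 remaining: hLiu418 = stmt-HodgeConjecture-24832, h413 =
stmt-HodgeConjecture-24833) until rung 0 closes.

## References
* [Shelstad1979] D. Shelstad, *Characters and inner forms of a quasi-split group over ℝ*, Compositio Math. 39 (1979) 11–45, §4 pp. 22–26, Lemma 4.2 (p. 23).
* [Bouaziz1994IntegralesOrbitales] A. Bouaziz, *Intégrales orbitales sur les groupes de Lie réductifs*, Ann. Sci. ÉNS (4) 27 (1994) 573–609, §3.1 p. 579, §6.2 p. 591.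
* [Rogawski1990] J. D. Rogawski, *Automorphic Representations of Unitary Groups in Three Variables*, Ann. of Math. Stud. 123 (1990), §4.1 (4.1.1) p. 39, §4.3 (4.3.1) p. 43.
-/

set_option autoImplicit false

noncomputable section

open Complex Finset Equiv
open scoped Classical
open Literature.NumberTheory.Automorphic.ArchCartan

namespace Literature.NumberTheory.Rogawski1990

variable {W : Type*} [Fintype W] [DecidableEq W]

/-! ## §1 The full Weyl symmetry (W^st) -/

section StableWeyl

/-- **(W^st) `ArchHcStableWeyl F`** — the STABLE Weyl symmetry of a Cartan-indexed family in the `R′`-currency: the division-free twisted relation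
`F S′ (swap c) · archRG S′ c = archRG S′ (swap c) · F S′ c` under EVERY transposition of two slots at EVERY compact place `w ∉ S′` (no sign guard — the realised AND the non-realised
reflections), and evenness in `x` at the split places.  (★ `ArchHcWeyl s` asks the first clause for the realised swaps `s w i = s w j` only.) [cite: Shelstad1979, §4 p. 23; Lemma 4.2 (p. 23)]
[cite: Bouaziz1994IntegralesOrbitales, §6.2 p. 591] -/
def ArchHcStableWeyl (F : Finset W → (W → Fin 3 → ℝ) → ℂ) : Prop :=
  (∀ (S' : Finset W) (c : W → Fin 3 → ℝ) (w : W) (i j : Fin 3), w ∉ S' → i ≠ j →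
      F S' (hcSwapAt w i j c) * archRG S' c = archRG S' (hcSwapAt w i j c) * F S' c) ∧
    ∀ (S' : Finset W) (c : W → Fin 3 → ℝ) (w : W), w ∈ S' → F S' (negXAt w c) = F S' c

/-- Unfolding of (W^st). [cite: Shelstad1979, §4 p. 23] -/
theorem archHcStableWeyl_iff (F : Finset W → (W → Fin 3 → ℝ) → ℂ) :
    ArchHcStableWeyl F ↔
      (∀ (S' : Finset W) (c : W → Fin 3 → ℝ) (w : W) (i j : Fin 3), w ∉ S' → i ≠ j →
          F S' (hcSwapAt w i j c) * archRG S' c = archRG S' (hcSwapAt w i j c) * F S' c) ∧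
        ∀ (S' : Finset W) (c : W → Fin 3 → ℝ) (w : W), w ∈ S' → F S' (negXAt w c) = F S' c := Iff.rfl

/-- (W^st) ⇒ (W) for every sign pattern `s`. [cite: Shelstad1979, §4 p. 23] -/
theorem ArchHcStableWeyl.archHcWeyl {F : Finset W → (W → Fin 3 → ℝ) → ℂ} (h : ArchHcStableWeyl F) (s : W → Fin 3 → SignType) : ArchHcWeyl s F :=
  ⟨fun S' c w i j hw hij _ => h.1 S' c w i j hw hij, h.2⟩

/-- (W) ⇒ the `x`-evenness clause. [cite: Shelstad1979, §4 p. 23] -/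
theorem ArchHcWeyl.negXAt {s : W → Fin 3 → SignType} {F : Finset W → (W → Fin 3 → ℝ) → ℂ} (h : ArchHcWeyl s F) :
    ∀ (S' : Finset W) (c : W → Fin 3 → ℝ) (w : W), w ∈ S' → F S' (negXAt w c) = F S' c := h.2

/-- The zero family is (W^st). [cite: Shelstad1979, §4 p. 23] -/
theorem archHcStableWeyl_zero : ArchHcStableWeyl (fun (_ : Finset W) (_ : W → Fin 3 → ℝ) => (0 : ℂ)) :=
  ⟨fun _ _ _ _ _ _ _ => by simp, fun _ _ _ _ => rfl⟩

/-- **`'F^st(swap c) = −'F^st(c)`** — the twisted stable sum is ALTERNATING under every slot transposition at a compact place, for ANY family `F` (reindex the partner sum by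
`ρ ↦ update ρ w (swap i j · ρ_w)`, ★ `sum_partnerPerms_comp_update`; the sign flips, ★ `prod_sign_update_swap_mul`). [cite: Shelstad1979, Lemma 4.2 (p. 23); §4 p. 24]
[cite: Bouaziz1994IntegralesOrbitales, §6.2 p. 591] -/
theorem archERhoG_mul_stableSumG_hcSwapAt (F : Finset W → (W → Fin 3 → ℝ) → ℂ) {S' : Finset W} {w : W} (hw : w ∉ S') {i j : Fin 3} (hij : i ≠ j) (c : W → Fin 3 → ℝ) :
    archERhoG S' (hcSwapAt w i j c) * stableSumG F S' (hcSwapAt w i j c) = -(archERhoG S' c * stableSumG F S' c) := by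
  rw [stableSumG, stableSumG, Finset.mul_sum, Finset.mul_sum, ← Finset.sum_neg_distrib]
  -- each summand at the swapped point is minus the summand of the relabelled index at `c`
  have hterm : ∀ ρ : W → Perm (Fin 3),
      archERhoG S' (hcSwapAt w i j c) * (stableTwistG S' ρ (hcSwapAt w i j c) * F S' (slotPerm ρ (hcSwapAt w i j c))) =
        -(archERhoG S' c * (stableTwistG S' (Function.update ρ w (Equiv.swap i j * ρ w)) c *
          F S' (slotPerm (Function.update ρ w (Equiv.swap i j * ρ w)) c))) := by
    intro ρ
    have h := stableTwistG_hcSwapAt_mul_archERhoG S' ρ w hij c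
    rw [slotPerm_hcSwapAt]
    calc archERhoG S' (hcSwapAt w i j c) * (stableTwistG S' ρ (hcSwapAt w i j c) * F S' (slotPerm (Function.update ρ w (Equiv.swap i j * ρ w)) c))
        = (stableTwistG S' ρ (hcSwapAt w i j c) * archERhoG S' (hcSwapAt w i j c)) * F S' (slotPerm (Function.update ρ w (Equiv.swap i j * ρ w)) c) := by ring
      _ = -(stableTwistG S' (Function.update ρ w (Equiv.swap i j * ρ w)) c * archERhoG S' c) *
            F S' (slotPerm (Function.update ρ w (Equiv.swap i j * ρ w)) c) := by rw [h]
      _ = _ := by ring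
  rw [Finset.sum_congr rfl fun ρ _ => hterm ρ]
  exact sum_partnerPerms_comp_update hw (Equiv.swap i j)
    (fun ρ => -(archERhoG S' c * (stableTwistG S' ρ c * F S' (slotPerm ρ c))))

/-- **THE STABLE SUM IS (W^st)** — for ANY family `F` that is even in `x` at the split places, `stableSumG F` satisfies the full division-free Weyl symmetry at every compact place
(alternation of `'F^st` and of the Weyl denominator `archERhoG·archRG`, ★ `archERhoG_mul_archRG_slotPerm`) and stays `x`-even. [cite: Shelstad1979, Lemma 4.2 (p. 23); §4 pp. 23–24]
[cite: Bouaziz1994IntegralesOrbitales, §6.2 p. 591] -/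
theorem archHcStableWeyl_stableSumG {F : Finset W → (W → Fin 3 → ℝ) → ℂ} (hx : ∀ (S' : Finset W) (c : W → Fin 3 → ℝ) (w : W), w ∈ S' → F S' (negXAt w c) = F S' c) :
    ArchHcStableWeyl (stableSumG F) := by
  refine ⟨fun S' c w i j hw hij => ?_, fun S' c w hw => ?_⟩
  · -- multiply through by the unit `archERhoG S′ (swap c) · archERhoG S′ c` and use the two alternations
    have hu1 : archERhoG S' (hcSwapAt w i j c) ≠ 0 := archERhoG_ne_zero' S' _
    have hu2 : archERhoG S' c ≠ 0 := archERhoG_ne_zero' S' c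
    have hΔ : archERhoG S' (hcSwapAt w i j c) * archRG S' (hcSwapAt w i j c) = -(archERhoG S' c * archRG S' c) := by
      rw [hcSwapAt_eq_slotPerm, archERhoG_mul_archRG_slotPerm (update_one_swap_mem_partnerPerms hw i j), prod_sign_update_one_swap w hij]
      ring
    have hT := archERhoG_mul_stableSumG_hcSwapAt F hw hij c
    apply mul_left_cancel₀ (mul_ne_zero hu1 hu2)
    calc archERhoG S' (hcSwapAt w i j c) * archERhoG S' c * (stableSumG F S' (hcSwapAt w i j c) * archRG S' c)
        = (archERhoG S' (hcSwapAt w i j c) * stableSumG F S' (hcSwapAt w i j c)) * (archERhoG S' c * archRG S' c) := by ring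
      _ = -(archERhoG S' c * stableSumG F S' c) * -(archERhoG S' (hcSwapAt w i j c) * archRG S' (hcSwapAt w i j c)) := by rw [hT, hΔ, neg_neg]
      _ = archERhoG S' (hcSwapAt w i j c) * archERhoG S' c * (archRG S' (hcSwapAt w i j c) * stableSumG F S' c) := by ring
  · rw [stableSumG, stableSumG]
    refine Finset.sum_congr rfl fun ρ hρ => ?_
    rw [stableTwistG_negXAt S' ρ hw, slotPerm_negXAt_of_eq_one (eq_one_of_mem_partnerPerms hρ hw), hx S' _ w hw]

/-- **On the regular set a (W^st) family is reproduced `|partnerPerms S′|` times by its stable sum**: `stableSumG F S′ c = card(partnerPerms S′) · F S′ c` for `c ∈ RegG S′`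
(each twisted partner term equals `'F(c)`: induction over the relabellings, one transposition at a time; the values of `F` ON the walls are not constrained by (W^st), hence the
restriction to `RegG`).  So the image of `stableSumG` on the `x`-even families is the (W^st) families, up to the positive multiplicity `6^{#(univ ∖ S′)}`.
[cite: Shelstad1979, Lemma 4.2 (p. 23)] [cite: Rogawski1990, §4.3 (4.3.1) p. 43] -/
theorem stableSumG_eq_card_mul_of_mem_regG {F : Finset W → (W → Fin 3 → ℝ) → ℂ} (h : ArchHcStableWeyl F) {S' : Finset W} {c : W → Fin 3 → ℝ} (hc : c ∈ RegG S') :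
    stableSumG F S' c = ((partnerPerms S').card : ℂ) * F S' c := by
  have hu : archERhoG S' c ≠ 0 := archERhoG_ne_zero' S' c
  apply mul_left_cancel₀ hu
  rw [archERhoG_mul_stableSumG]
  -- every twisted partner term equals `'F(c)` on the regular set
  have hterm : ∀ ρ ∈ partnerPerms S', (∏ w, (Equiv.Perm.sign (ρ w) : ℂ)) * (archERhoG S' (slotPerm ρ c) * F S' (slotPerm ρ c)) = archERhoG S' c * F S' c := by
    refine partnerPerms_induction (P := fun ρ => ∀ c : W → Fin 3 → ℝ, c ∈ RegG S' →
      (∏ w, (Equiv.Perm.sign (ρ w) : ℂ)) * (archERhoG S' (slotPerm ρ c) * F S' (slotPerm ρ c)) = archERhoG S' c * F S' c) ?_ ?_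
      |> fun H ρ hρ => H ρ hρ c hc
    · intro c _
      have h1 : ∏ w', (Equiv.Perm.sign ((1 : W → Perm (Fin 3)) w') : ℂ) = 1 :=
        Finset.prod_eq_one fun w' _ => by rw [Pi.one_apply, Equiv.Perm.sign_one, Units.val_one, Int.cast_one]
      rw [h1, slotPerm_one, one_mul]
    · intro ρ hρ w hw x y hxy ih c hc
      -- the new partner point is the slot swap of the old one, at which (W^st) flips the twisted value
      set c' : W → Fin 3 → ℝ := slotPerm ρ c with hc'
      have hc'reg : c' ∈ RegG S' := (slotPerm_mem_regG_iff hρ c).2 hc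
      have hx' : (ρ w).symm x ≠ (ρ w).symm y := fun e => hxy ((ρ w).symm.injective e)
      have hswap : slotPerm (Function.update ρ w (Equiv.swap x y * ρ w)) c = hcSwapAt w ((ρ w).symm x) ((ρ w).symm y) c' := by
        rw [slotPerm_update_swap_mul]; rfl
      have hsign := prod_sign_update_swap_mul ρ w hxy
      -- (W^st) at `c′`, multiplied by the twists: `'F(swap c′)·Δ(c′) = Δ(swap c′)·'F(c′)` with `Δ(swap c′) = −Δ(c′)`
      have hW := h.1 S' c' w _ _ hw hx'
      have hΔ : archERhoG S' (hcSwapAt w ((ρ w).symm x) ((ρ w).symm y) c') * archRG S' (hcSwapAt w ((ρ w).symm x) ((ρ w).symm y) c') =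
          -(archERhoG S' c' * archRG S' c') := by
        rw [hcSwapAt_eq_slotPerm, archERhoG_mul_archRG_slotPerm (update_one_swap_mem_partnerPerms hw _ _), prod_sign_update_one_swap w hx']
        ring
      have hR : archRG S' c' ≠ 0 := archRG_ne_zero_of_mem_regG hc'reg
      have hE : archERhoG S' c' ≠ 0 := archERhoG_ne_zero' S' c'
      -- twisted anti-invariance of `F` at the regular point `c′`
      have hanti : archERhoG S' (hcSwapAt w ((ρ w).symm x) ((ρ w).symm y) c') * F S' (hcSwapAt w ((ρ w).symm x) ((ρ w).symm y) c') =
          -(archERhoG S' c' * F S' c') := by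
        apply mul_left_cancel₀ (mul_ne_zero hR hE)
        calc archRG S' c' * archERhoG S' c' * (archERhoG S' (hcSwapAt w ((ρ w).symm x) ((ρ w).symm y) c') * F S' (hcSwapAt w ((ρ w).symm x) ((ρ w).symm y) c'))
            = archERhoG S' c' * archERhoG S' (hcSwapAt w ((ρ w).symm x) ((ρ w).symm y) c') *
                (F S' (hcSwapAt w ((ρ w).symm x) ((ρ w).symm y) c') * archRG S' c') := by ring
          _ = archERhoG S' c' * archERhoG S' (hcSwapAt w ((ρ w).symm x) ((ρ w).symm y) c') *
                (archRG S' (hcSwapAt w ((ρ w).symm x) ((ρ w).symm y) c') * F S' c') := by rw [hW]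
          _ = archERhoG S' c' * (archERhoG S' (hcSwapAt w ((ρ w).symm x) ((ρ w).symm y) c') * archRG S' (hcSwapAt w ((ρ w).symm x) ((ρ w).symm y) c')) * F S' c' := by ring
          _ = archRG S' c' * archERhoG S' c' * -(archERhoG S' c' * F S' c') := by rw [hΔ]; ring
      rw [hsign, hswap, neg_mul, hanti, mul_neg, neg_neg]
      exact ih c hc
  rw [Finset.sum_congr rfl hterm, Finset.sum_const, nsmul_eq_mul]
  ring

/-- **Idempotence up to multiplicity**: for an `x`-even family, `stableSumG (stableSumG F) S′ c = card(partnerPerms S′) · stableSumG F S′ c` on `RegG S′`.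
[cite: Shelstad1979, Lemma 4.2 (p. 23)] -/
theorem stableSumG_stableSumG_of_mem_regG {F : Finset W → (W → Fin 3 → ℝ) → ℂ} (hx : ∀ (S' : Finset W) (c : W → Fin 3 → ℝ) (w : W), w ∈ S' → F S' (negXAt w c) = F S' c)
    {S' : Finset W} {c : W → Fin 3 → ℝ} (hc : c ∈ RegG S') :
    stableSumG (stableSumG F) S' c = ((partnerPerms S').card : ℂ) * stableSumG F S' c :=
  stableSumG_eq_card_mul_of_mem_regG (archHcStableWeyl_stableSumG hx) hc

/-- The multiplicity is positive: `card(partnerPerms S′) = 6^{#(univ ∖ S′)} ≠ 0`. [cite: Rogawski1990, §4.3 (4.3.1) p. 43] -/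
theorem card_partnerPerms_ne_zero (S' : Finset W) : ((partnerPerms S').card : ℂ) ≠ 0 := by
  rw [Nat.cast_ne_zero]
  exact Finset.card_ne_zero.2 ⟨1, one_mem_partnerPerms S'⟩

end StableWeyl

/-! ## §2 Inheritance of periodicity and compact support -/

section Inherit

/-- **(P) is inherited**: the stable sum of an angle-periodic family is angle-periodic (the relabelled shift is an angle shift of the relabelled slot; the twist reads angles through
`Circle.exp`). [cite: Shelstad1979, §4 p. 22] [cite: Bouaziz1994IntegralesOrbitales, §3.1 p. 579] -/
theorem archHcPeriodic_stableSumG {F : Finset W → (W → Fin 3 → ℝ) → ℂ} (hP : ArchHcPeriodic F) : ArchHcPeriodic (stableSumG F) := by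
  intro S' c w i k hwi
  rw [stableSumG, stableSumG]
  refine Finset.sum_congr rfl fun ρ hρ => ?_
  rw [stableTwistG_add_angleShift, slotPerm_add_angleShift]
  congr 1
  refine hP S' (slotPerm ρ c) w ((ρ w).symm i) k ?_
  rcases hwi with hw | hi
  · exact Or.inl hw
  · by_cases hw : w ∈ S'
    · right
      rw [eq_one_of_mem_partnerPerms hρ hw]
      exact hi
    · exact Or.inl hw

/-- **(I₄) is inherited**: the stable sum of a family compactly supported modulo conjugacy is so (the partner relabellings do not move the split coordinates).
[cite: Bouaziz1994IntegralesOrbitales, §3.1 p. 579] -/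
theorem archHcCompactSupport_stableSumG {F : Finset W → (W → Fin 3 → ℝ) → ℂ} (h : ArchHcCompactSupport F) : ArchHcCompactSupport (stableSumG F) := by
  intro S'
  obtain ⟨Rb, hRb⟩ := h S'
  refine ⟨Rb, fun c hc => ?_⟩
  rw [stableSumG]
  refine Finset.sum_eq_zero fun ρ hρ => ?_
  obtain ⟨w, hw, hlt⟩ := hc
  rw [hRb (slotPerm ρ c) ⟨w, hw, by rwa [slotPerm_apply_of_mem hρ hw]⟩, mul_zero]

end Inherit

end Literature.NumberTheory.Rogawski1990

end
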